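import Summits.ResolutionOfSingularities.ResolutionOfSingularities.Theorems.HilbertSamuelEliminationSigmaMaxModificationsCorridor3WLadderStrataClean
import HarnessLib

/-!
# [OURS · L1 W4.2] The STRATA-half of the MOVING W-ladder, eighth layer (part 2/2): the cycle-start regularity row (c-reg) REDUCED
# to the two ONE-STEP geometric kernels (K-ctr) / (K-str) of part 1/2 by the LABEL CALCULUS — PROVED

Crux chain w42 (`SigmaMaxModifications`, stmt-ResolutionOfSingularities-18506; skeleton `w_ladder` v6 on
`SigmaMaxModificationsCorridor3`, stmt-ResolutionOfSingularities-19249), row «stub-4 → `Moving.Wlow3CharStrataM p`», seat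
res-L1-w42-stub-4 (gen 4); companion of p500484 / p503069 / p503885 / p504439 / p505314 / p506465 / p508074 / p508693 /
p510273 / p511345. OURS (cell res-hironaka, slot W4.2); NOT statements of H. Hironaka's manuscript [Hironaka2017] nor of
[CossartJannsenSaito2020]; AI-drafted, weaker than expert review. Pure proofs (no definitions); uses part 1/2
(`…Corridor3WLadderStrataClean`: `IsRegularCurveAt`, `LabelCleanAt`, rows (K-ctr) `StrataCentreMembersClean` / (K-str)
`StrataStrictTransformClean`, `LabelCleanAt.mem_regularLocus`, `.persist`, `labelCleanAt_birth`, `labelCleanAt_reset`). Helper file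
`--supports stmt-ResolutionOfSingularities-19249`.

## The argument (no geometry)

Row (c-reg) `StrataCycleStartRegular` (p508074) asks: at late cycle STARTS `r` the reduced treated part `S_r = (Y_r^{(j)})_red`
is regular at the chain point. Call a label `j` CLEAN at stage `n` (`LabelCleanAt`) when the label-`j` irreducible components of
`X_n(ν)` THROUGH THE CHAIN POINT `x_n` number at most one, and that one (if present) is, at `x_n`, a regular CURVE — «regular»
read on the ambient local ring, `𝒪_{X_n,x_n}/I(Z)_{x_n}` regular (= the local ring of the reduced subscheme `Z_red` at its point over
`x_n`, tree `isRegularLocalRing_stalk_subscheme_iff`), «curve» topologically (no irreducible closed set strictly between `{x_n}`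
and `Z`). The label calculus of CJS Rem. 6.29 (1) («dominates ⇒ inherits; otherwise the new label») gives:

* (persist) a clean label `j ≤ year` stays clean at the next stage: its members through `x_{n+1}` dominate THE clean member `Z`
  through `x_n`; if `Z` lies in the canonical centre they are «members over the centre» — kernel (K-ctr); if not, they are
  dominants of a regular curve off the centre — kernel (K-str);
* (birth) the new label `year + 1` is clean: newborn components lie over the centre (p505314
  `StepProjection.subset_preimage_support_of_not_mem`), so (K-ctr) applies;
* (reset) after a CYCLE-END step (centre = the whole treated part `Y_n^{(j)}`, p503069 `support_eq_part_of_next_none`) the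
  treated label `j` is clean: its members through `x_{n+1}` dominate members inside the centre — (K-ctr) again.

Hence every label born late is clean for ever, and every OLD label is clean from the end of its first late cycle on; at a cycle
start the treated label keeps being treated until the cycle's end (`lbl_eq_treatedLabel`), so each old label offers AT MOST ONE
unclean late cycle start — finitely many exceptions in all. Finally a clean treated label gives a treated part regular at the
chain point: near `x_r` the part `Y_r^{(j)}` IS its unique member through `x_r` (the other label-`j` components are closed and miss
`x_r`), and the stalk of a vanishing ideal depends only on the germ of the closed set (tree `stalkIdeal_vanishingIdeal_congr`).

So `strataCycleStartRegular_of_clean : StrataCentreMembersClean p N Q G → StrataStrictTransformClean p N Q G →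
StrataCycleStartRegular p N Q G` (any `Q`, `G`), and by name `wlow3CharStrataM_of_fibre_curve_centreIO_clean`. The geometric content
left is ONE-STEP and LOCAL AT THE CHAIN POINT (intended proofs, `G = (ē ≤ 2)`): (K-ctr) — over a blown-up chain point the components
of `X_{n+1}(ν)` through `x_{n+1}` mapping into the centre are: none in the fibre unless the centre is the point `x_n` (Thm. 3.14,
near-fibre rendering p514197), then the near line `ℙ(Dir_{x_n}(X_n)) ≅ ℙ^1_{k(x_n)}` (Thm. 3.14 point-centre locus p503241, `e = 2`);
over a centre CURVE `D ∋ x_n` the unique component dominating `D` (Thm. 3.6: `e_η ≤ e_{x_n} − 1 ≤ 1` at the generic point `η` of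
`D`; Thm. 3.14 at `η` after localisation, Prop. 6.31; `ℙ(Dir_η) = ℙ^0`: `ProjDir_line`, PROVED p509891), which is birational onto the
regular curve `D` with `k(η)`-rational generic point, hence regular at `x_{n+1}` (a local ring strictly between a DVR and its fraction
field does not exist); (K-str) — the strict transform of a curve regular at `x_n` under a blow-up whose centre does not contain it
is regular at its (unique) point over `x_n` (same DVR argument; the blow-down is an isomorphism off the centre).

References: CJS LNM 2270 Rem. 6.29 (1) pp. 91–92, p. 102, Thm. 3.6, Thm. 3.14, Prop. 6.31 [CossartJannsenSaito2020]; Stacks 01J7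
[StacksProject]; tree `Literature…CanonicalEliminationSequence` (`Labelling`, `IsCanonicalStep`), `…BoundarySplitting`
(`stalkIdeal_vanishingIdeal_congr`), `…PointBlowupHsFunMono` (`isRegularLocalRing_stalk_subscheme_iff`), this seat's files above.
-/

noncomputable section

-- plan-1/idea-2 module setting kept (namespace `…Corridor3.Moving` re-enters `…Corridor3`)
set_option linter.dupNamespace false

open CategoryTheory AlgebraicGeometry TopologicalSpace Topology IsLocalRing
open Summit.ResolutionOfSingularities.ResolutionOfSingularities.Theorems.CampaignW42
open Literature.AlgebraicGeometry.Resolution Literature.RingTheory.HilbertSamuel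
open Literature.AlgebraicGeometry.CossartJannsenSaito2020
open Summit.ResolutionOfSingularities.ResolutionOfSingularities.Theorems.SigmaMaxModificationsCorridor3

universe u

namespace Summit.ResolutionOfSingularities.ResolutionOfSingularities.Theorems.SigmaMaxModificationsCorridor3.Moving

variable {R : ∀ S : Scheme.{u}, CentreSeq S → Prop} {N : ℕ} {ν : ℕ → ℕ}

/-! ## §5. Row (c-reg) from the kernels (K-ctr) and (K-str) -/

/-- **Inside a cycle the treated label is kept until the cycle's end**: if `(c (m+1)).P ≠ none` for `r ≤ m < e`, then
`treatedLabel (c e) = treatedLabel (c r)`. [cite: CossartJannsenSaito2020, Rem. 6.29 (1)] -/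
theorem treatedLabel_eq_of_cycle {c : ℕ → MarkedStage.{u}} (hstep : ∀ n, CanonicalNearStep R N ν (c n) (c (n + 1)))
    {r e : ℕ} (hre : r ≤ e) (hcyc : ∀ m, r ≤ m → m < e → (c (m + 1)).P ≠ none) :
    treatedLabel N ν (c e) = treatedLabel N ν (c r) := by
  obtain ⟨d, rfl⟩ := Nat.exists_eq_add_of_le hre
  induction d with
  | zero => rfl
  | succ d ih =>
    have h1 : treatedLabel N ν (c (r + d)) = treatedLabel N ν (c r) :=
      ih (Nat.le_add_right r d) fun m hm hme => hcyc m hm (by omega)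
    have hP : (c (r + d + 1)).P ≠ none := hcyc (r + d) (Nat.le_add_right r d) (by omega)
    obtain ⟨Q', hQ'⟩ := Option.ne_none_iff_exists'.mp hP
    rw [show r + (d + 1) = r + d + 1 by omega, treatedLabel_of_some hQ', (hstep (r + d)).lbl_eq_treatedLabel hQ', h1]

/-- **ROW (c-reg) FROM THE KERNELS (K-ctr) AND (K-str) — PROVED** (any origin predicate `Q`, any grade `G`; the label calculus of the
module docstring: late-born labels are clean for ever, each old label is clean from the end of its first late cycle on, so all but
finitely many cycle starts treat a clean label, whose part is regular at the chain point). [cite: CossartJannsenSaito2020, Rem. 6.29 (1)] -/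
theorem strataCycleStartRegular_of_clean {p N : ℕ} {Q : ℕ → (ℕ → ℕ) → ∀ X : Scheme.{u}, X → Prop}
    {G : MarkedStage.{u} → Prop} (hK : StrataCentreMembersClean p N Q G) (hS : StrataStrictTransformClean p N Q G) :
    StrataCycleStartRegular p N Q G := by
  intro R hRf hRa ν X _ x hX hQ c h0 hstep hG hnI hmov
  obtain ⟨n₁, hn₁⟩ := hK R hRf hRa ν X x hX hQ c h0 hstep hG hnI hmov
  obtain ⟨n₂, hn₂⟩ := hS R hRf hRa ν X x hX hQ c h0 hstep hG hnI hmov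
  -- cycle package, label invariant, step projections, years
  obtain ⟨hν, k, _, hinv⟩ := exists_cycleInv_chain' hRf hRa hX h0 hstep
  have hlab : ∀ n, LabelInv N ν (c n) := fun n =>
    (labelInv_init (N := N) (ν := ν) X x).of_reaches (reaches_chain h0 hstep n)
  have hpt : ∀ n, (c n).pt ∈ Scheme.hsStratum (c n).W N ν := fun n =>
    pt_mem_hsStratum_of_reaches hX.mem_stratum (reaches_chain h0 hstep n)
  have hne : ∀ n, (Scheme.hsStratum (c n).W N ν).Nonempty := fun n => ⟨_, hpt n⟩
  have hyear : ∀ n, (c n).L.year = (c 0).L.year + n := by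
    intro n
    induction n with
    | zero => rfl
    | succ n ih => rw [(hstep n).year_eq, ih]; omega
  choose f hf using fun n => (hstep n).exists_stepProjection
  -- the one-step lemmas along the late part of the chain
  set m₀ := max n₁ n₂ with hm₀
  have hpersist : ∀ n, m₀ ≤ n → ∀ j, j ≤ (c n).L.year → LabelCleanAt N ν (c n) j → LabelCleanAt N ν (c (n + 1)) j := by
    intro n hn j hj hclean
    obtain ⟨C, P', hln, x', hcs, -, -, -, -⟩ := hstep n
    exact hclean.persist (hf n) (fun hxC => hn₁ n (le_of_max_le_left hn) C P' hcs hxC (f n) (hf n))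
      (fun Z hZ hZC hreg => hn₂ n (le_of_max_le_right hn) C P' hcs (f n) (hf n) Z hZ hZC hreg) hj
  have hbirth : ∀ n, m₀ ≤ n → LabelCleanAt N ν (c (n + 1)) ((c n).L.year + 1) := by
    intro n hn
    obtain ⟨C, P', hln, x', hcs, -, -, -, -⟩ := hstep n
    exact labelCleanAt_birth hRf hRa hν (hinv n) (hlab n) (hf n) hcs
      (fun hxC => hn₁ n (le_of_max_le_left hn) C P' hcs hxC (f n) (hf n))
  have hreset : ∀ n, m₀ ≤ n → (c (n + 1)).P = none → LabelCleanAt N ν (c (n + 1)) (treatedLabel N ν (c n)) := by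
    intro n hn hnone
    obtain ⟨C, P', hln, x', hcs, -, -, -, -⟩ := hstep n
    exact labelCleanAt_reset hRf (hlab n) (hf n) hnone hcs (hne n)
      (fun hxC => hn₁ n (le_of_max_le_left hn) C P' hcs hxC (f n) (hf n))
  -- persistence for ever
  have hpersist' : ∀ n, m₀ ≤ n → ∀ j, j ≤ (c n).L.year → LabelCleanAt N ν (c n) j →
      ∀ d, LabelCleanAt N ν (c (n + d)) j := by
    intro n hn j hj hclean d
    induction d with
    | zero => exact hclean
    | succ d ih =>
      rw [← add_assoc]
      exact hpersist (n + d) (by omega) j (by rw [hyear] at hj ⊢; omega) ih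
  -- late-born labels are clean from birth on
  have hnew : ∀ d j, (c m₀).L.year < j → LabelCleanAt N ν (c (m₀ + d)) j := by
    intro d
    induction d with
    | zero => exact fun j hj => labelCleanAt_of_year_lt (hlab m₀) hj
    | succ d ih =>
      intro j hj
      rcases Nat.lt_trichotomy j ((c (m₀ + d)).L.year + 1) with hlt | heq | hgt
      · rw [← add_assoc]
        exact hpersist (m₀ + d) (by omega) j (by omega) (ih j hj)
      · rw [← add_assoc, heq]
        exact hbirth (m₀ + d) (by omega)
      · rw [← add_assoc]
        exact labelCleanAt_of_year_lt (hlab (m₀ + d + 1)) (by rw [(hstep (m₀ + d)).year_eq]; omega)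
  -- every label has a bound past which its cycle starts are clean
  have hb : ∀ j, ∃ b, ∀ r, b ≤ r → (c r).P = none → treatedLabel N ν (c r) = j → LabelCleanAt N ν (c r) j := by
    intro j
    by_cases hjY : (c m₀).L.year < j
    · refine ⟨m₀, fun r hr _ _ => ?_⟩
      obtain ⟨d, rfl⟩ := Nat.exists_eq_add_of_le hr
      exact hnew d j hjY
    by_cases hex : ∃ r₀, m₀ ≤ r₀ ∧ (c r₀).P = none ∧ treatedLabel N ν (c r₀) = j
    · obtain ⟨r₀, hr₀, hP₀, ht₀⟩ := hex
      -- the end `e` of the cycle starting at `r₀`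
      classical
      have hend : ∃ m, r₀ ≤ m ∧ (c (m + 1)).P = none := exists_next_none hstep r₀
      let e := Nat.find hend
      have he : r₀ ≤ e ∧ (c (e + 1)).P = none := Nat.find_spec hend
      have hmin : ∀ m, r₀ ≤ m → m < e → (c (m + 1)).P ≠ none := fun m hm hme hP =>
        Nat.find_min hend hme ⟨hm, hP⟩
      have hte : treatedLabel N ν (c e) = j := (treatedLabel_eq_of_cycle hstep he.1 hmin).trans ht₀
      have hclean : LabelCleanAt N ν (c (e + 1)) j := hte ▸ hreset e (hr₀.trans he.1) he.2
      have hjy : j ≤ (c (e + 1)).L.year := by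
        rw [← hte, (hstep e).year_eq]
        exact (treatedLabel_le_year (hlab e) (hne e)).trans (Nat.le_succ _)
      refine ⟨e + 1, fun r hr _ _ => ?_⟩
      obtain ⟨d, rfl⟩ := Nat.exists_eq_add_of_le hr
      exact hpersist' (e + 1) (by omega) j hjy hclean d
    · refine ⟨m₀, fun r hr hP ht => ?_⟩
      exact absurd ⟨r, hr, hP, ht⟩ hex
  choose b hb using hb
  -- past all the bounds of the old labels (and `m₀`), every cycle start treats a clean label
  refine ⟨(Finset.range ((c m₀).L.year + 1)).sup b + m₀, fun r hr hPr hcl y hy => ?_⟩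
  have hclean : LabelCleanAt N ν (c r) (treatedLabel N ν (c r)) := by
    by_cases hjY : (c m₀).L.year < treatedLabel N ν (c r)
    · obtain ⟨d, rfl⟩ := Nat.exists_eq_add_of_le (show m₀ ≤ r by omega)
      exact hnew d _ hjY
    · have hle : b (treatedLabel N ν (c r)) ≤ (Finset.range ((c m₀).L.year + 1)).sup b :=
        Finset.le_sup (Finset.mem_range.mpr (by omega))
      exact hb _ r (by omega) hPr rfl
  haveI : IsNoetherian (c r).W := (hinv r).isNoetherian
  exact hclean.mem_regularLocus (hinv r).isClosed_hsStratum hcl y hy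

/-! ## §6. The strata-half with (c-reg) replaced by the kernels -/

/-- **`Wlow3CharStrataM p` (G1′) FROM (b-fib), (b-curve), (c-geo), (K-ctr), (K-str)** (by name; `N = 3`, `Q = QNe (QCharRegime p)`,
`G = (ē ≤ 2)`). [cite: CossartJannsenSaito2020, Thm. 3.14, Thm. 6.35, Rem. 6.29 (1)] -/
theorem wlow3CharStrataM_of_fibre_curve_centreIO_clean {p : ℕ}
    (hfib : StrataNearFibreSubsingleton.{0} p 3 (QNe (Helpers.QCharRegime p)) fun s => s.geomDirDim ≤ 2)
    (hcurve : StrataCentreCurveAt.{0} p 3 (QNe (Helpers.QCharRegime p)) fun s => s.geomDirDim ≤ 2)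
    (hgeo : StrataLineageInCentreIO.{0} p 3 (QNe (Helpers.QCharRegime p)) fun s => s.geomDirDim ≤ 2)
    (hK : StrataCentreMembersClean.{0} p 3 (QNe (Helpers.QCharRegime p)) fun s => s.geomDirDim ≤ 2)
    (hS : StrataStrictTransformClean.{0} p 3 (QNe (Helpers.QCharRegime p)) fun s => s.geomDirDim ≤ 2) :
    Wlow3CharStrataM p :=
  wlow3CharStrataM_of_fibre_curve_centreIO_cycleStartRegular hfib hcurve hgeo (strataCycleStartRegular_of_clean hK hS)

/-- **`WlowStrataM p` (regime-free) FROM (b-fib), (b-curve), (c-geo), (K-ctr), (K-str)** (`Q = ⊤`).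
[cite: CossartJannsenSaito2020, Thm. 3.14, Thm. 6.35, Rem. 6.29 (1)] -/
theorem wlowStrataM_of_fibre_curve_centreIO_clean {p : ℕ}
    (hfib : StrataNearFibreSubsingleton.{0} p 3 (QNe fun _ _ _ _ => True) fun s => s.geomDirDim ≤ 2)
    (hcurve : StrataCentreCurveAt.{0} p 3 (QNe fun _ _ _ _ => True) fun s => s.geomDirDim ≤ 2)
    (hgeo : StrataLineageInCentreIO.{0} p 3 (QNe fun _ _ _ _ => True) fun s => s.geomDirDim ≤ 2)
    (hK : StrataCentreMembersClean.{0} p 3 (QNe fun _ _ _ _ => True) fun s => s.geomDirDim ≤ 2)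
    (hS : StrataStrictTransformClean.{0} p 3 (QNe fun _ _ _ _ => True) fun s => s.geomDirDim ≤ 2) : WlowStrataM p :=
  wlowStrataM_of_fibre_curve_centreIO_cycleStartRegular hfib hcurve hgeo (strataCycleStartRegular_of_clean hK hS)

/-- The strata row implies (K-ctr) and (K-str) (vacuously), so the decomposition stays EXACT. [folklore] -/
theorem maxOriginNoMovingNearChainAtQ_notIso_iff_fibre_curve_centreIO_clean {p N : ℕ}
    {Q : ℕ → (ℕ → ℕ) → ∀ X : Scheme.{u}, X → Prop} {G : MarkedStage.{u} → Prop} :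
    (MaxOriginNoMovingNearChainAtQ p N Q fun s => G s ∧ ¬ Iso N s) ↔
      StrataNearFibreSubsingleton p N (QNe Q) G ∧ StrataCentreCurveAt p N (QNe Q) G ∧
        StrataLineageInCentreIO p N (QNe Q) G ∧ StrataCentreMembersClean p N (QNe Q) G ∧
          StrataStrictTransformClean p N (QNe Q) G := by
  refine ⟨fun h => ?_, fun ⟨hfib, hcurve, hgeo, hK, hS⟩ =>
    maxOriginNoMovingNearChainAtQ_notIso_of_fibre_curve_centreIO_cycleStartRegular hfib hcurve hgeo
      (strataCycleStartRegular_of_clean hK hS)⟩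
  have h4 := maxOriginNoMovingNearChainAtQ_notIso_iff_fibre_curve_centreIO_cycleStartRegular.mp h
  have h' := maxOriginNoMovingNearChainAtQ_qNe_of_q h
  refine ⟨h4.1, h4.2.1, h4.2.2.1,
    fun R hRf hRa ν X _ x hX hQ c h0 hstep hG hnI hmov =>
      (h' R hRf hRa ν X x hX hQ ⟨c, h0, hstep, fun n => ⟨hG n, hnI n⟩, hmov⟩).elim,
    fun R hRf hRa ν X _ x hX hQ c h0 hstep hG hnI hmov =>
      (h' R hRf hRa ν X x hX hQ ⟨c, h0, hstep, fun n => ⟨hG n, hnI n⟩, hmov⟩).elim⟩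

end Summit.ResolutionOfSingularities.ResolutionOfSingularities.Theorems.SigmaMaxModificationsCorridor3.Moving

end
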